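import Mathlib.GroupTheory.Archimedean
import Mathlib.GroupTheory.OrderOfElement
import HarnessLib

/-!
# Subgroups of an abelian group generated by two elements are generated by two elements (FILE C, piece (C-β))

Cell `bsd-print-cf2`, width seat `bsd-line-cf2-p1-w8` g8, `--supports` the DECIDING class crux
`PrintCf2RubinValueTwo.MainConjClauseAtSplitTwoQuadDAClass` (stmt-BirchSwinnertonDyer-23300; stub `stub_localAtom` / (U1) f.g. half)
as a helper. THEOREMS ONLY; Mathlib only. HONEST FRAMING: group theory; no summit statement is proved; BSD is not proved.

WHY. In FILE C (the semilocal assembly of the local atom) the decomposition group `D_w` of a place `w` of `F_n` above `v` is a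
subgroup of `⟨γ̄₁, γ̄₂⟩ = Gal(F_n/K₀)` (abelian, generated by the restrictions of the two topological generators), and cf2c-w5
g11's local devissage `LeopoldtAtV.exists_cover_of_devissage` wants it PRESENTED as `D_w = ⟨σ⟩·⟨τ⟩`: a cyclic filtration
`D ⊇ ⟨τ⟩ ⊇ 1` with cyclic quotient `⟨σ̄⟩`. This file supplies the presentation: for a commutative group `H` whose elements are the
`g₁^i g₂^j` and ANY subgroup `D ≤ H`, there are `σ, τ ∈ D` with `D = {σ^i τ^j}`; moreover `τ ∈ ⟨g₂⟩`, `σ ∉`-part: every `d ∈ D`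
is `σ^k τ^l`, and `τ` generates `D ⊓ ⟨g₂⟩` (so `σ̄` generates the image of `D` in `H/⟨g₂⟩`, cyclic). Proof: the exponent sets
`{j : g₂^j ∈ D}` and `{i : ∃ j, g₁^i g₂^j ∈ D}` are subgroups of `ℤ`, hence cyclic (`Int.subgroup_cyclic`).

* `exists_two_generators_of_subgroup` (ℤ-exponents), `exists_two_generators_of_subgroup_nat` (ℕ-exponents, `H` finite).

References: standard (subgroups of `ℤ²`); S. Lang, *Algebra* I §8. [folklore]
-/

set_option linter.dupNamespace false
set_option autoImplicit false

namespace Summit.BirchSwinnertonDyer.BirchSwinnertonDyer.Theorems.PrintCf2.UnitsFGLayerBound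

/-- **A subgroup of an abelian group generated by two elements is generated by two of its elements**, the second one a power
of the second generator: if every `h ∈ H` is `g₁^i g₂^j`, then for every `D ≤ H` there are `σ, τ ∈ D`, `τ ∈ ⟨g₂⟩`, with every
`d ∈ D` of the form `σ^k τ^l` and every element of `D ⊓ ⟨g₂⟩` a power of `τ`. [folklore] -/
theorem exists_two_generators_of_subgroup {H : Type*} [CommGroup H] (g₁ g₂ : H)
    (hgen : ∀ h : H, ∃ i j : ℤ, h = g₁ ^ i * g₂ ^ j) (D : Subgroup H) :
    ∃ σ ∈ D, ∃ τ ∈ D, (∃ m : ℤ, τ = g₂ ^ m) ∧ (∀ j : ℤ, g₂ ^ j ∈ D → ∃ l : ℤ, g₂ ^ j = τ ^ l) ∧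
      ∀ d ∈ D, ∃ k l : ℤ, d = σ ^ k * τ ^ l := by
  -- the exponents `j` with `g₂^j ∈ D`
  let T : AddSubgroup ℤ :=
    { carrier := {j | g₂ ^ j ∈ D}
      zero_mem' := by simp [D.one_mem]
      add_mem' := fun {a b} ha hb ↦ by
        simp only [Set.mem_setOf_eq] at ha hb ⊢
        rw [zpow_add]; exact D.mul_mem ha hb
      neg_mem' := fun {a} ha ↦ by
        simp only [Set.mem_setOf_eq] at ha ⊢
        rw [zpow_neg]; exact D.inv_mem ha }
  -- the exponents `i` with `g₁^i g₂^j ∈ D` for some `j`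
  let I : AddSubgroup ℤ :=
    { carrier := {i | ∃ j : ℤ, g₁ ^ i * g₂ ^ j ∈ D}
      zero_mem' := ⟨0, by simp [D.one_mem]⟩
      add_mem' := fun {a b} ha hb ↦ by
        obtain ⟨j, hj⟩ := ha
        obtain ⟨j', hj'⟩ := hb
        refine ⟨j + j', ?_⟩
        have e : g₁ ^ (a + b) * g₂ ^ (j + j') = (g₁ ^ a * g₂ ^ j) * (g₁ ^ b * g₂ ^ j') := by
          rw [zpow_add, zpow_add]; ac_rfl
        rw [e]; exact D.mul_mem hj hj'
      neg_mem' := fun {a} ha ↦ by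
        obtain ⟨j, hj⟩ := ha
        refine ⟨-j, ?_⟩
        have e : g₁ ^ (-a) * g₂ ^ (-j) = (g₁ ^ a * g₂ ^ j)⁻¹ := by
          rw [zpow_neg, zpow_neg, mul_inv]
        rw [e]; exact D.inv_mem hj }
  obtain ⟨m, hm⟩ := Int.subgroup_cyclic T
  obtain ⟨n, hn⟩ := Int.subgroup_cyclic I
  have hnI : n ∈ I := by rw [hn]; exact AddSubgroup.mem_closure_singleton.2 ⟨1, one_smul _ _⟩
  obtain ⟨j₀, hj₀⟩ := hnI
  have hmT : m ∈ T := by rw [hm]; exact AddSubgroup.mem_closure_singleton.2 ⟨1, one_smul _ _⟩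
  refine ⟨g₁ ^ n * g₂ ^ j₀, hj₀, g₂ ^ m, hmT, ⟨m, rfl⟩, fun j hj ↦ ?_, fun d hd ↦ ?_⟩
  · -- `g₂^j ∈ D` ⟹ `j ∈ T = ℤ·m`
    have hjT : j ∈ T := hj
    rw [hm] at hjT
    obtain ⟨l, hl⟩ := AddSubgroup.mem_closure_singleton.1 hjT
    refine ⟨l, ?_⟩
    rw [← zpow_mul, ← hl, smul_eq_mul, mul_comm]
  · obtain ⟨i, j, rfl⟩ := hgen d
    have hiI : i ∈ I := ⟨j, hd⟩
    rw [hn] at hiI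
    obtain ⟨k, hk⟩ := AddSubgroup.mem_closure_singleton.1 hiI
    -- `d · σ^{-k} = g₂^{j − k j₀} ∈ D`
    have hrest : g₂ ^ (j - k * j₀) ∈ D := by
      have e : (g₁ ^ i * g₂ ^ j) * (g₁ ^ n * g₂ ^ j₀) ^ (-k) = g₂ ^ (j - k * j₀) := by
        rw [← hk, smul_eq_mul, mul_zpow, ← zpow_mul, ← zpow_mul, mul_mul_mul_comm, ← zpow_add, ← zpow_add,
          show k * n + n * -k = 0 by ring, show j + j₀ * -k = j - k * j₀ by ring, zpow_zero, one_mul]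
      rw [← e]; exact D.mul_mem hd (D.zpow_mem hj₀ _)
    have hT' : (j - k * j₀) ∈ T := hrest
    rw [hm] at hT'
    obtain ⟨l, hl⟩ := AddSubgroup.mem_closure_singleton.1 hT'
    refine ⟨k, l, ?_⟩
    rw [← zpow_mul, show m * l = l • m from by rw [smul_eq_mul, mul_comm], hl, mul_zpow, ← zpow_mul, ← zpow_mul, ← hk,
      smul_eq_mul, mul_assoc, ← zpow_add]
    congr 1
    · rw [mul_comm]
    · congr 1; ring

/-- **The same with natural exponents** when `g₁, g₂` have finite order (e.g. `H` finite): every `d ∈ D` is `σ^k τ^l` with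
`k, l : ℕ`, and every element of `D ⊓ ⟨g₂⟩` is `τ^l`, `l : ℕ`. [folklore] -/
theorem exists_two_generators_of_subgroup_nat {H : Type*} [CommGroup H] [Finite H] (g₁ g₂ : H)
    (hgen : ∀ h : H, ∃ i j : ℤ, h = g₁ ^ i * g₂ ^ j) (D : Subgroup H) :
    ∃ σ ∈ D, ∃ τ ∈ D, (∃ m : ℕ, τ = g₂ ^ m) ∧ (∀ j : ℕ, g₂ ^ j ∈ D → ∃ l : ℕ, g₂ ^ j = τ ^ l) ∧
      ∀ d ∈ D, ∃ k l : ℕ, d = σ ^ k * τ ^ l := by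
  have hnat : ∀ (x : H) (z : ℤ), ∃ n : ℕ, x ^ z = x ^ n := fun x z ↦
    ⟨(z % (orderOf x : ℤ)).toNat, by
      rw [← zpow_natCast, Int.toNat_of_nonneg (Int.emod_nonneg _ (by exact_mod_cast (isOfFinOrder_of_finite x).orderOf_pos.ne')),
        zpow_mod_orderOf]⟩
  obtain ⟨σ, hσ, τ, hτ, ⟨m, hm⟩, hT, hD⟩ := exists_two_generators_of_subgroup g₁ g₂ hgen D
  refine ⟨σ, hσ, τ, hτ, ?_, fun j hj ↦ ?_, fun d hd ↦ ?_⟩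
  · obtain ⟨m', hm'⟩ := hnat g₂ m
    exact ⟨m', hm.trans hm'⟩
  · obtain ⟨l, hl⟩ := hT j (by exact_mod_cast hj)
    obtain ⟨l', hl'⟩ := hnat τ l
    exact ⟨l', by rw [← zpow_natCast, hl, hl']⟩
  · obtain ⟨k, l, rfl⟩ := hD d hd
    obtain ⟨k', hk'⟩ := hnat σ k
    obtain ⟨l', hl'⟩ := hnat τ l
    exact ⟨k', l', by rw [hk', hl']⟩

end Summit.BirchSwinnertonDyer.BirchSwinnertonDyer.Theorems.PrintCf2.UnitsFGLayerBound
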